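import Mathlib
import HarnessLib
import Literature.MathematicalPhysics.KineticTheory.HardSphereEulerProofs
import Literature.Analysis.FluidPDE.HardSphereCollisionRecord
import Summits.AtomisticToContinuum.HydrodynamicLimit.Theses.OneFlightGossipEngine
import Summits.AtomisticToContinuum.HydrodynamicLimit.Theorems.OneFlightGossipEngineClampedCurrentsDockClampedMeasurable
import Summits.AtomisticToContinuum.HydrodynamicLimit.Theorems.OneFlightGossipEngineClampedCurrentsDockHeartTools

/-! # Measurable versions of the clamped rows minus a one-body window functional
— stub `stub_clampedFunctionalMeasurable` (S4) of line `Sketch`, crux `LocalClampedTransferLDAlongFamilies`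
(stmt-AtomisticToContinuum-17691)

For `N+1` hard spheres of diameter `ε_N = σ(N+1)^{-1/3}` on `𝕋³` (`0 < σ < 1/2`), a hard-sphere flow `Φ`, the window
`w = τ(N+1)^{-1/3}`, a clamp level `V`, a continuous test function `ψ` and a continuous one-body integrand `g`, the
functionals `z ↦ w⁻¹ Xm_k(z) − w⁻¹ A(z)` (`k = 0, 1, 2`) and `z ↦ w⁻¹ Xe(z) − w⁻¹ A(z)` agree on the good set `Φ.good`
with measurable functions. Here `Xm_k, Xe` are the transfer-CLAMPED collisional rows (collision sums over the
collisions of the orbit with times in `(0, w]`, weighted by `ω_fst ω_snd`, `ω_i = 𝟙{act_i ≤ V}`, `act_i` the window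
transfer activity of particle `i`) and `A(z) = ∫₀ʷ Σ_i g(Φ_r z i) dr − C` is a one-body window functional.

Outline: (1) the activities agree on the good set with measurable functions `Am i` (label-aware collision sums read
through the collision mark, `ClampedCurrentsDockClampedMeasurable.measurable_indicator_collisionSum_mark`); (2) on
the good set the clamp weights come out of the finite collision sum (`collisionSum_clamped_eq_sum`) and the split rows
are measurable (`measurable_clampedRow`, which uses the test function only through its continuity); (3) the one-body
window functional is measurable on the good subtype (sum and integral commute along a good orbit,
`ClampedCurrentsDockHeart.integral_sum_orbit`, then `measurable_sum_windowIntegral`); (4) a function measurable on the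
good subtype agrees on the good set with a measurable function (`exists_measurable_eqOn_good`), and measurability is
stable under the linear combination `w⁻¹ X − w⁻¹ A`.
References: S. Olla, S. R. S. Varadhan, H.-T. Yau, Comm. Math. Phys. 155 (1993) 523–560, §2–3; H. Spohn, *Large Scale
Dynamics of Interacting Particles* (1991), Part I §2.3; H.-T. Yau, Lett. Math. Phys. 22 (1991) 63–80, §2.
-/

noncomputable section

open MeasureTheory Set Filter
open scoped ENNReal Topology BigOperators

namespace Summit.AtomisticToContinuum.HydrodynamicLimit.Theorems.LocalClampedTransferSketch

open Literature.Analysis.FluidPDE (HardSphereFlow Config localMaxwellian canonicalDensity liouville hardSphereDomain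
  configEnergy)
open Literature.MathematicalPhysics.KineticTheory (T3 V3 hsDiameter localGibbsLaw localGibbsMeasure localGibbsProfile
  rhoLim profileOf hsCompressibility)
open Literature.Analysis.FluidPDE Literature.MathematicalPhysics.KineticTheory Literature.Analysis.FunctionSpaces
open Summit.AtomisticToContinuum.HydrodynamicLimit.Theorems.ClampedCurrentsDockClampedMeasurable
  (measurable_indicator_collisionSum_mark collisionSum_clamped_eq_sum measurable_clampedRow)
open Summit.AtomisticToContinuum.HydrodynamicLimit.Theorems.ClampedCurrentsDockHeart
  (exists_measurable_eqOn_good measurable_sum_windowIntegral integral_sum_orbit)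

variable {σ : ℝ} {N : ℕ}

/-! ## Tools: measurability on the good subtype -/

/-- A function agreeing on the good set with a measurable function is measurable on the good subtype. -/
theorem measurable_restrict_good_of_eqOn {ε : ℝ} {M : ℕ} (Φ : HardSphereFlow (Torus.geometry (Fin 3)) ε M)
    {f Y : Config M (Fin 3) T3 → ℝ} (hY : Measurable Y) (h : Set.EqOn Y f Φ.good) :
    Measurable fun z : Φ.good => f z := by
  have e : (fun z : Φ.good => f z) = fun z : Φ.good => Y z := funext fun z => (h z.2).symm
  rw [e]
  exact hY.comp measurable_subtype_coe

/-- The window integral of the particle sum of a continuous one-body functional is measurable on the good subtype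
(sum and integral commute along a good orbit, then `ClampedCurrentsDockHeart.measurable_sum_windowIntegral`). -/
theorem measurable_windowIntegral_sum {ε : ℝ} {M : ℕ} (Φ : HardSphereFlow (Torus.geometry (Fin 3)) ε M)
    {F : T3 × V3 → ℝ} (hF : Continuous F) (a b : ℝ) :
    Measurable fun z : Φ.good => ∫ r in a..b, ∑ i : Fin M, F (Φ.flow r (z : Config M (Fin 3) T3) i) := by
  have e : (fun z : Φ.good => ∫ r in a..b, ∑ i : Fin M, F (Φ.flow r (z : Config M (Fin 3) T3) i)) =
      fun z : Φ.good => ∑ i : Fin M, ∫ r in a..b, F (Φ.flow r (z : Config M (Fin 3) T3) i) :=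
    funext fun z => integral_sum_orbit Φ z.2 hF a b
  rw [e]
  exact measurable_sum_windowIntegral Φ hF a b

/-- **Measurable versions of the window transfer activities**: for every scale `κ`, window `w` and label `i`, the
functional `z ↦ κ Σ_{collisions c in (0, w], c.fst = i} (‖Δv‖ + |Δ‖v‖²|/2)` agrees on the good set with a measurable
function (the summand read through the collision mark, `measurable_indicator_collisionSum_mark`; `0 < σ < 1/2`). -/
theorem exists_measurable_activity (hσ : 0 < σ) (hσ2 : σ < 1 / 2)
    (Φ : HardSphereFlow (Torus.geometry (Fin 3)) (hsDiameter σ N) (N + 1)) (κ w : ℝ) (i : Fin (N + 1)) :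
    ∃ Am : Config (N + 1) (Fin 3) T3 → ℝ, Measurable Am ∧ Set.EqOn Am (fun z =>
      κ * Φ.collisionSum (Set.Ioc 0 w) (fun c => if c.fst = i then ‖c.postVel.1 - c.preVel.1‖ +
        |‖c.postVel.1‖ ^ 2 - ‖c.preVel.1‖ ^ 2| / 2 else 0) z) Φ.good := by
  -- adapted from `ClampedCurrentsDockClampedMeasurable.stub_clampedFunctionalsMeasurable` (the step `hCm`)
  have hCm : Measurable (Φ.good.indicator fun z => Φ.collisionSum (Ioc 0 w) (fun c =>
      if c.fst = i then ‖c.postVel.1 - c.preVel.1‖ + |‖c.postVel.1‖ ^ 2 - ‖c.preVel.1‖ ^ 2| / 2 else 0) z) := by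
    refine measurable_indicator_collisionSum_mark hσ hσ2 Φ
      (Q := fun i' _ _ _ v v' => if i' = i then ‖v' - v‖ + |‖v'‖ ^ 2 - ‖v‖ ^ 2| / 2 else 0) (fun i' _ => ?_) 0 w
    by_cases hi : i' = i
    · simp only [hi, if_true]
      fun_prop
    · simp only [hi, if_false]
      exact continuous_const
  exact ⟨_, hCm.const_mul κ, fun z hz => by simp only [indicator_of_mem hz]⟩

/-! ## The stub -/

/-- **S4 — measurable versions of the clamped rows minus a one-body window functional** (stub
`stub_clampedFunctionalMeasurable` of line `Sketch`, crux `LocalClampedTransferLDAlongFamilies`,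
stmt-AtomisticToContinuum-17691): for a continuous test function `ψ`, a continuous one-body integrand `g` and a
constant `C`, the functionals `z ↦ w⁻¹ Xm_k(z) − w⁻¹ (∫₀ʷ Σ_i g(Φ_r z i) dr − C)` (`k = 0, 1, 2`) and the energy-row
analogue agree on the good set with measurable functions: measurable versions of the activities
(`exists_measurable_activity`), clamp weights pulled out of the finite collision sum (`collisionSum_clamped_eq_sum`)
and the split rows read through the mark (`measurable_clampedRow`), the window part by
`measurable_windowIntegral_sum`, glued by `exists_measurable_eqOn_good`. -/
theorem stub_clampedFunctionalMeasurable :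
    ∀ (σ : ℝ) (N : ℕ) (Φ : HardSphereFlow (Torus.geometry (Fin 3)) (hsDiameter σ N) (N + 1))
      (τ V C : ℝ) (ψ : T3 → ℝ) (g : T3 × V3 → ℝ), 0 < σ → σ < 1 / 2 → 0 < τ →
      Continuous ψ → Continuous g →
      (let w : ℝ := τ * ((N : ℝ) + 1) ^ (-(1 / 3 : ℝ))
       let act := fun (i : Fin (N + 1)) (z : Config (N + 1) (Fin 3) T3) =>
         σ / τ * Φ.collisionSum (Set.Ioc 0 w)
           (fun c => if c.fst = i then ‖c.postVel.1 - c.preVel.1‖ +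
             |‖c.postVel.1‖ ^ 2 - ‖c.preVel.1‖ ^ 2| / 2 else 0) z
       let ω := fun (i : Fin (N + 1)) (z : Config (N + 1) (Fin 3) T3) =>
         if act i z ≤ V then (1 : ℝ) else 0
       let Xm := fun (k : Fin 3) (z : Config (N + 1) (Fin 3) T3) =>
         Φ.collisionSum (Set.Ioc 0 w) (fun c => ω c.fst z * ω c.snd z *
           ((ψ c.fstPos - ψ c.sndPos) * (c.postVel.1 k - c.preVel.1 k)) / 2) z
       let Xe := fun (z : Config (N + 1) (Fin 3) T3) =>
         Φ.collisionSum (Set.Ioc 0 w) (fun c => ω c.fst z * ω c.snd z *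
           ((ψ c.fstPos - ψ c.sndPos) * ((‖c.postVel.1‖ ^ 2 - ‖c.preVel.1‖ ^ 2) / 2)) / 2) z
       let A := fun (z : Config (N + 1) (Fin 3) T3) =>
         (∫ r in (0 : ℝ)..w, ∑ i : Fin (N + 1), g ((Φ.flow r z) i)) - C
       (∀ k : Fin 3, ∃ Y : Config (N + 1) (Fin 3) T3 → ℝ, Measurable Y ∧
          Set.EqOn Y (fun z => w⁻¹ * Xm k z - w⁻¹ * A z) Φ.good) ∧
       (∃ Y : Config (N + 1) (Fin 3) T3 → ℝ, Measurable Y ∧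
          Set.EqOn Y (fun z => w⁻¹ * Xe z - w⁻¹ * A z) Φ.good)) := by
  intro σ N Φ τ V C ψ g hσ hσ2 _hτ hψ hg w act ω Xm Xe A
  -- (1) measurable versions `Am i` of the activities, and the clamp weights at a good datum
  choose Am hAm hAeq using fun i => exists_measurable_activity hσ hσ2 Φ (σ / τ) w i
  have hωA : ∀ z ∈ Φ.good, ∀ i, (if Am i z ≤ V then (1 : ℝ) else 0) = ω i z := fun z hz i => by
    have h1 : Am i z = act i z := hAeq i hz
    rw [h1]
  -- (2) the clamped rows are measurable on the good subtype
  have hXm : ∀ k : Fin 3, Measurable fun z : Φ.good => Xm k z := fun k => by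
    refine measurable_restrict_good_of_eqOn Φ (f := Xm k)
      (measurable_clampedRow hσ hσ2 Φ hψ (δ := fun v v' => v' k - v k) (by fun_prop) hAm V 0 w) fun z hz => ?_
    simp only [hωA z hz, indicator_of_mem hz]
    exact (collisionSum_clamped_eq_sum Φ hz (fun i => ω i z) _ w).symm
  have hXe : Measurable fun z : Φ.good => Xe z := by
    refine measurable_restrict_good_of_eqOn Φ (f := Xe)
      (measurable_clampedRow hσ hσ2 Φ hψ (δ := fun v v' => (‖v'‖ ^ 2 - ‖v‖ ^ 2) / 2) (by fun_prop) hAm V 0 w)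
      fun z hz => ?_
    simp only [hωA z hz, indicator_of_mem hz]
    exact (collisionSum_clamped_eq_sum Φ hz (fun i => ω i z) _ w).symm
  -- (3) the one-body window functional is measurable on the good subtype
  have hA : Measurable fun z : Φ.good => A z := (measurable_windowIntegral_sum Φ hg 0 w).sub_const C
  -- (4) measurable versions of the linear combinations
  refine ⟨fun k => exists_measurable_eqOn_good Φ ?_, exists_measurable_eqOn_good Φ ?_⟩
  · exact ((hXm k).const_mul w⁻¹).sub (hA.const_mul w⁻¹)
  · exact (hXe.const_mul w⁻¹).sub (hA.const_mul w⁻¹)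

end Summit.AtomisticToContinuum.HydrodynamicLimit.Theorems.LocalClampedTransferSketch

end
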